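import Mathlib
import HarnessLib
import Summits.KontsevichZagierPeriods.Zeta5Search.TwoTaleWhippleP15
import Summits.KontsevichZagierPeriods.Zeta5Search.TwoTaleWhippleRemark5

/-!
# TwoTaleWhippleDischarged — the Whipple input of both two-tale rungs DISCHARGED

HONEST FRAMING: systematic search; no irrationality claim unless certified.

fam-measure (pub-zeta5), FAMILY.md §10.11, successor task G1 COMPLETED.  `TwoTaleWhippleRemark5.remark5Max`
proves Zudilin's Remark 5 [cite: Zudilin2014ZetaTwo, Remark 5] on the cone `a₁, a₂, a₃ ≤ a₄` (Whipple's
transformation, `HypergeometricWhipple` + `TwoTaleWhippleBinomial`), i.e. the named input `WhippleRemark5Max` of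
`TwoTaleWhippleP15` holds outright: `whippleRemark5Max_holds`.  Consequently the growth-side inputs of BOTH rungs
are theorems — `whippleP15_holds : WhippleP15` (`q_n = −q̂_n` at P15), `whippleA_holds : WhippleA` (rung A) —
and so are the coefficient rates `coeffRate_holds : CoeffRate C₁star` (P15) and `coeffRateA_holds : CoeffRateA
C₁starA` (rung A).  The measure statements now rest on fam-denom's named inputs ONLY:
* **`zetaTwo_exponent_le_P15 : Inclusion → Decay 29.10787 → ExponentLE (zetaValue 2) 5.0499 ∧
  Zudilin2014.zetaTwo_irrationalityExponent_le`** (robust: `Decay 29.1 → … 5.0521 ∧ …`),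
* **`zetaTwo_exponent_le_A : InclusionA → DecayA 13.229 → ExponentLE (zetaValue 2) 5.2053`**.
`Inclusion(A)` (denominators) and `Decay(A) c` (the (bmiss)-dependent integral decay) are UNPROVED named inputs
owned by fam-denom / P1; nothing about `ζ(2)` is certified here (0 certified measures).
-/

namespace Summit.KontsevichZagierPeriods.Zeta5Search.TwoTaleWhipple

open Literature.NumberTheory.Irrationality
open Literature.NumberTheory.Irrationality.Zudilin2014
open Summit.KontsevichZagierPeriods.Zeta5Search

/-- **Zudilin's Remark 5 on the cone `a₁, a₂, a₃ ≤ a₄` holds** (the named input `WhippleRemark5Max`).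
[cite: Zudilin2014ZetaTwo, Remark 5; Slater1966, (2.4.2.3)] -/
theorem whippleRemark5Max_holds : WhippleRemark5Max :=
  fun a₁ a₂ a₃ a₄ b₄ h₁ h₂ h₃ hadm => TwoTaleWhippleRemark5.remark5Max a₁ a₂ a₃ a₄ b₄ h₁ h₂ h₃ hadm

/-- **`WhippleP15` holds**: `q_n = −q̂_n` for the P15 two-tale pair, every `n ≥ 1`. -/
theorem whippleP15_holds : TwoTaleP15Growth.WhippleP15 := whippleP15_of_remark5Max whippleRemark5Max_holds

/-- **`WhippleA` holds**: `q_n = −q̂_n` for rung A `(6,5,4,7 | 0,1,2,12) ↔ (15,5,6,7 | 7,3,11,12)`, every `n ≥ 1`. -/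
theorem whippleA_holds : TwoTaleR3Growth.WhippleA := whippleA_of_remark5Max whippleRemark5Max_holds

/-- P15: `qP15 n = −qhatP15 n` for `n ≥ 1`. -/
theorem qP15_eq_neg_qhatP15_holds {n : ℕ} (hn : 1 ≤ n) : TwoTaleP15.qP15 n = -TwoTaleP15.qhatP15 n :=
  qP15_eq_neg_qhatP15_ofMax whippleRemark5Max_holds hn

/-- P15: fam-denom's `formQ n = −qhat n` for `n ≥ 1`. -/
theorem formQ_eq_neg_qhat_holds {n : ℕ} (hn : 1 ≤ n) :
    Denom.TwoTaleP15Forms.formQ n = -((TwoTaleP15Growth.qhat n : ℕ) : ℤ) :=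
  whippleP15_holds n hn

/-- Rung A: fam-denom's `formQA n = −formQTZ (aTA n) (bTA n)` for `n ≥ 1`. -/
theorem formQA_eq_neg_formQTZ_holds {n : ℕ} (hn : 1 ≤ n) :
    Denom.TwoTaleR3Forms.formQA n = -formQTZ (aTA n) (bTA n) :=
  formQA_eq_neg_formQTZ_ofMax whippleRemark5Max_holds hn

/-- **The P15 coefficient rate holds**: `CoeffRate C₁star` (growth input of fam-denom's assembly). -/
theorem coeffRate_holds : Denom.TwoTaleP15Forms.CoeffRate TwoTaleP15Growth.C₁star :=
  TwoTaleP15Growth.coeffRate_of_whipple whippleP15_holds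

/-- **The rung-A coefficient rate holds**: `CoeffRateA C₁starA`. -/
theorem coeffRateA_holds : Denom.TwoTaleR3Forms.CoeffRateA TwoTaleR3Growth.C₁starA :=
  TwoTaleR3Growth.coeffRateA_of_whipple whippleA_holds

section Packaged

open Literature.NumberTheory.Transcendental (zetaValue)
open Summit.KontsevichZagierPeriods.Zeta5Search.Denom.TwoTaleR3Forms (InclusionA DecayA)
open Summit.KontsevichZagierPeriods.Zeta5Search.Denom.TwoTaleP15Forms (Inclusion Decay)

/-- **P15: `Inclusion → Decay 29.10787 → μ(ζ(2)) ≤ 5.0499`** (and the 2014 record statement).  Named unproved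
inputs: `Inclusion`, `Decay 29.10787` (fam-denom; both rest on the missing zero (bmiss) at P15).  The growth side
is now a theorem. -/
theorem zetaTwo_exponent_le_P15 (hI : Inclusion) (hD : Decay 29.10787) :
    ExponentLE (zetaValue 2) 5.0499 ∧ Zudilin2014.zetaTwo_irrationalityExponent_le :=
  zetaTwo_exponent_le_of_remark5MaxP15 hI hD whippleRemark5Max_holds

/-- P15, robust decay constant: `Inclusion → Decay 29.1 → μ(ζ(2)) ≤ 5.0521 ∧ record`. -/
theorem zetaTwo_exponent_le_P15_robust (hI : Inclusion) (hD : Decay 29.1) :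
    ExponentLE (zetaValue 2) 5.0521 ∧ Zudilin2014.zetaTwo_irrationalityExponent_le :=
  TwoTaleP15Growth.zetaTwo_exponent_le_of_whipple₃_robust hI hD whippleP15_holds

/-- **Rung A: `InclusionA → DecayA 13.229 → μ(ζ(2)) ≤ 5.2053`.**  Named unproved inputs: `InclusionA`,
`DecayA 13.229` (fam-denom / P1). -/
theorem zetaTwo_exponent_le_A (hI : InclusionA) (hD : DecayA 13.229) : ExponentLE (zetaValue 2) 5.2053 :=
  zetaTwo_exponent_le_of_remark5MaxA hI hD whippleRemark5Max_holds

/-- Rung A, loose decay constant: `InclusionA → DecayA 13.2 → μ(ζ(2)) ≤ 5.233`. -/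
theorem zetaTwo_exponent_le_A_loose (hI : InclusionA) (hD : DecayA 13.2) : ExponentLE (zetaValue 2) 5.233 :=
  TwoTaleR3Growth.zetaTwo_exponent_le_looseA_of_whipple₃ hI hD whippleA_holds

end Packaged

end Summit.KontsevichZagierPeriods.Zeta5Search.TwoTaleWhipple
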